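import Summits.Ventures.Crystal3D.Theorems.StickyWulffConstantNoReconstructionGainSteepFlat
import Summits.Ventures.Crystal3D.Theorems.StickyWulffConstantNoReconstructionGainSteepFlatRobust
import Summits.Ventures.Crystal3D.StickySpheres.TriangularDiscCount
import Summits.Ventures.Crystal3D.Theorems.StickyWulffConstantNoReconstructionGainFccShell
import HarnessLib

/-!
# Steep-or-flat overlayers of the `(111)` facet gain nothing (first off-lattice rung of the atom)

HONEST FRAMING. Part of the venture `Summits/Ventures/Crystal3D` (cell `crystal3d-full`), helper
`--supports` the crux `NoReconstructionGain` (stmt-Ventures-19144, route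
`route-Ventures-StickyWulffConstant`).  The atom at the normal `ν = (111)` (`= e₃` in the frame
of `fccStacking 1 √(2/3)`, whose close-packed layers are horizontal) asks that NO finite unit
packing containing the fcc slab sample gains contacts at order area over the two flat faces.
Here: this holds for every STEEP-OR-FLAT packing (every bond with `|Δz| ≤ 1/5` or
`|Δz| ≥ 4/5`; see `StickyWulffConstantNoReconstructionGainSteepFlat{,Robust}.lean` for what the
class contains — all registered / Barlow films, layered disordered films, adatom gases, AND an
open neighbourhood of all of these) — the first rung of the atom that is not confined to a
lattice or a registered stacking, and a stable one.

* `steepFlat_noGain111` — with `R = 2`, `C = 8√3π`: for `ρ ≥ R` and a unit packing `x` whose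
  bonds have each `|Δz| ≤ 1/5` or `|Δz| ≥ 4/5`, containing the fcc `(111)` slab sample of lateral
  radius `ρ` between heights `−2R` and `−R`, `2√3·π·ρ² − C·ρ ≤ 6N − numContacts x` (statement
  shape of `registry_noGain111` / `barlowAxis_noGain` with the registry hypothesis replaced by
  the bond dichotomy).  Proof: the robust layer bound at the sample level `−3√(2/3) ∈ [−4, −2]`
  plus the disc count `triangular_disc_count` (`≥ (2/√3)π(ρ − 2)²` fcc sites of that layer are
  balls of `x`).  `steepFlat_noGain111_sqrt` — the same with the close-packed threshold `√(2/3)`.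
* `steepFlat_noGain111_of_sub_mem_barlowStacking` — the in-registry rungs recovered as the
  special case of packings on a translate of one Barlow stacking.
* `four_fifths_le_sqrt_two_thirds`, `steepOrFlat_four_fifths_of_sqrt` — threshold bookkeeping.
* `phiFcc_single_two` (`φ(e₃) = √3` for the crux's inlined `φ`) and
  `steepFlat_noReconstructionGain_single_two` — the same rung written as the crux's inner
  statement at `ν = e₃` (its slab sample and its `φ`), restricted to steep-or-flat packings.

WHAT THIS IS NOT: not `NoReconstructionGain` (all normals, all packings) nor its `(111)` case for
arbitrary overlayers (oblique bonds open); nothing about the Crystallization conjunct; rung F-C1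
of the cell is not moved.
-/

noncomputable section

namespace Summit.Ventures.Crystal3D.Theorems

open Summit.Ventures.Crystal3D Finset Real
open Literature.MathematicalPhysics.StatisticalMechanics (barlowPos barlowStacking fccStacking
  constHagg isHaggSeq_const haggLabel_const IsHaggSeq barlowPos_mem barlowPos_apply_zero
  barlowPos_apply_one barlowPos_apply_two le_dist_barlowPos_of_ideal)
open scoped InnerProductSpace

/-! ## No gain over the `(111)` facet for steep-or-flat packings -/

/-- **`SteepFlatNoGain111` — the first OFF-LATTICE rung of the atom at `ν = (111)`.**  With
`R = 2`, `C = 8√3π`: for every `ρ ≥ R` and every steep-or-flat unit packing `x : Fin N → ℝ³`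
(every bond nearly horizontal, `|Δz| ≤ 1/5`, or steep, `|Δz| ≥ 4/5`) containing the fcc
`(111)` slab sample of lateral radius `ρ` between heights `−2R` and `−R`
(`Λ₀ = fccStacking 1 √(2/3)`, layers horizontal), `2√3·π·ρ² − C·ρ ≤ 6N − numContacts x`:
no such overlayer — registered or not: restacked / twinned films, rotated (moiré), strained or
amorphous layers at close-packed spacing, vacancies, islands, adatom gases and rumpled monolayers
with heights in `[√(2/3), 1]`, on both faces, plus anything lateral — gains contacts at order
area over the two flat `(111)` faces (`φ(111) = √3` per unit area per face).
Proof: the robust layer bound (`t = 4/5`) at the sample level `−3√(2/3) ∈ [−4, −2]`, whose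
occupancy is at least the number of triangular-lattice sites in the disc of radius `ρ`,
`≥ (2/√3)π(ρ − 2)²` (`triangular_disc_count`).  Supersedes the in-registry rungs
`registry_noGain111` / `barlowAxis_noGain` (`steepOrFlat_of_sub_mem_barlowStacking`), and is
stable: the hypothesis is open around every layered film. -/
theorem steepFlat_noGain111 :
    ∃ R C : ℝ, 0 < R ∧
      ∀ ρ : ℝ, R ≤ ρ → ∀ (N : ℕ) (x : Fin N → EuclideanSpace ℝ (Fin 3)), IsUnitPacking x →
        (∀ i j, dist (x i) (x j) = 1 →
          |x i 2 - x j 2| ≤ 1 / 5 ∨ 4 / 5 ≤ |x i 2 - x j 2|) →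
        (∀ p ∈ fccStacking 1 (Real.sqrt (2 / 3)),
            -(2 * R) ≤ p 2 → p 2 ≤ -R → p 0 ^ 2 + p 1 ^ 2 ≤ ρ ^ 2 → ∃ i, x i = p) →
          2 * Real.sqrt 3 * Real.pi * ρ ^ 2 - C * ρ ≤ 6 * (N : ℝ) - (numContacts x : ℝ) := by
  classical
  refine ⟨2, 8 * Real.sqrt 3 * Real.pi, by norm_num, ?_⟩
  intro ρ hρ N x hx hsf hsample
  have h3 : (0 : ℝ) < Real.sqrt 3 := Real.sqrt_pos.2 (by norm_num)
  have h3sq : Real.sqrt 3 ^ 2 = 3 := Real.sq_sqrt (by norm_num)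
  have hh : (Real.sqrt (2 / 3)) ^ 2 = 2 / 3 * (1 : ℝ) ^ 2 := by
    rw [Real.sq_sqrt (by norm_num)]; ring
  have hlow : (2 : ℝ) / 3 ≤ Real.sqrt (2 / 3) := by
    nlinarith [Real.sq_sqrt (show (0 : ℝ) ≤ 2 / 3 by norm_num), Real.sqrt_nonneg (2 / 3)]
  have hhigh : Real.sqrt (2 / 3) ≤ 1 := Real.sqrt_le_one.mpr (by norm_num)
  -- equal fcc positions have equal coordinates
  have hfcc_inj : ∀ {k₁ a₁ b₁ k₂ a₂ b₂ : ℤ},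
      barlowPos 1 (Real.sqrt (2 / 3)) constHagg k₁ a₁ b₁ =
        barlowPos 1 (Real.sqrt (2 / 3)) constHagg k₂ a₂ b₂ → (k₁, a₁, b₁) = (k₂, a₂, b₂) := by
    intro k₁ a₁ b₁ k₂ a₂ b₂ heq
    by_contra hne
    have h1 := le_dist_barlowPos_of_ideal isHaggSeq_const one_pos hh hne
    rw [heq, dist_self] at h1
    exact absurd h1 (by norm_num)
  -- the steep-or-flat layer bound at the level `c = -3 √(2/3)`
  set c : ℝ := -3 * Real.sqrt (2 / 3) with hc
  set E := univ.filter fun i => x i 2 = c with hE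
  have hlayer := three_mul_card_level_add_numContacts_le_four_fifths x hx hsf c
  -- balls that ARE fcc sites of layer `-3` sit at the level
  set E' := univ.filter fun i =>
    ∃ ab : ℤ × ℤ, x i = barlowPos 1 (Real.sqrt (2 / 3)) constHagg (-3) ab.1 ab.2 with hE'
  have hE'E : E' ⊆ E := by
    intro i hi
    rw [hE', mem_filter] at hi
    obtain ⟨ab, hab⟩ := hi.2
    rw [hE, mem_filter]
    refine ⟨mem_univ _, ?_⟩
    rw [hab, barlowPos_apply_two, hc]; push_cast; ring
  -- fcc coordinates of the fcc balls, and the disc they contain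
  set g : Fin N → ℤ × ℤ := fun i =>
    if h : ∃ ab : ℤ × ℤ, x i = barlowPos 1 (Real.sqrt (2 / 3)) constHagg (-3) ab.1 ab.2
    then h.choose else (0, 0) with hg
  set T : Finset (ℤ × ℤ) := E'.image g with hT
  have hTE : T.card ≤ E.card := card_image_le.trans (card_le_card hE'E)
  have hdisc := triangular_disc_count ((3 : ℝ) / 2) (Real.sqrt 3 / 2) ρ hρ T ?_
  swap
  · intro i j hcond
    set p := barlowPos 1 (Real.sqrt (2 / 3)) constHagg (-3) i j with hp
    have hp2 : p 2 = -3 * Real.sqrt (2 / 3) := by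
      rw [hp, barlowPos_apply_two]; push_cast; ring
    have hp0 : p 0 = (i : ℝ) + (j : ℝ) / 2 - 3 / 2 := by
      rw [hp, barlowPos_apply_zero, haggLabel_const]; push_cast; ring
    have hp1 : p 1 = Real.sqrt 3 / 2 * (j : ℝ) - Real.sqrt 3 / 2 := by
      rw [hp, barlowPos_apply_one, haggLabel_const]; push_cast; ring
    obtain ⟨i', hi'⟩ := hsample p (barlowPos_mem _ _ _) (by rw [hp2]; nlinarith)
      (by rw [hp2]; nlinarith) (by rw [hp0, hp1]; nlinarith [hcond])
    have hex : ∃ ab : ℤ × ℤ, x i' = barlowPos 1 (Real.sqrt (2 / 3)) constHagg (-3) ab.1 ab.2 :=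
      ⟨(i, j), hi'⟩
    have hi'E : i' ∈ E' := by
      rw [hE', mem_filter]; exact ⟨mem_univ _, hex⟩
    have hgi : g i' = (i, j) := by
      have hspec := hex.choose_spec
      have := hfcc_inj (hi'.symm.trans hspec)
      simp only [Prod.mk.injEq] at this
      rw [hg]; simp only [hex, dif_pos]
      exact Prod.ext this.2.1.symm this.2.2.symm
    rw [hT, mem_image]
    exact ⟨i', hi'E, hgi⟩
  -- assemble
  have hE' : 3 * (E.card : ℝ) + (numContacts x : ℝ) ≤ 6 * (N : ℝ) := by exact_mod_cast hlayer
  have hTE' : (T.card : ℝ) ≤ (E.card : ℝ) := by exact_mod_cast hTE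
  have hkey : 3 * (2 / Real.sqrt 3 * Real.pi * (ρ - 2) ^ 2) =
      2 * Real.sqrt 3 * Real.pi * ρ ^ 2 - 8 * Real.sqrt 3 * Real.pi * ρ +
        8 * Real.sqrt 3 * Real.pi := by
    field_simp
    nlinarith [h3sq]
  have hpos : 0 ≤ 8 * Real.sqrt 3 * Real.pi := by positivity
  nlinarith [hdisc, hkey, Real.pi_pos]

/-- `4/5 ≤ √(2/3)`: the close-packed steepness implies the robust one. -/
theorem four_fifths_le_sqrt_two_thirds : (4 : ℝ) / 5 ≤ Real.sqrt (2 / 3) := by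
  rw [show (4 : ℝ) / 5 = Real.sqrt ((4 / 5) ^ 2) by rw [Real.sqrt_sq (by norm_num)]]
  exact Real.sqrt_le_sqrt (by norm_num)

/-- A bond dichotomy with the close-packed threshold `√(2/3)` implies the robust one (`4/5`). -/
theorem steepOrFlat_four_fifths_of_sqrt {N : ℕ} {x : Fin N → EuclideanSpace ℝ (Fin 3)}
    (hsf : ∀ i j, dist (x i) (x j) = 1 →
      |x i 2 - x j 2| ≤ 1 / 5 ∨ Real.sqrt (2 / 3) ≤ |x i 2 - x j 2|) :
    ∀ i j, dist (x i) (x j) = 1 → |x i 2 - x j 2| ≤ 1 / 5 ∨ 4 / 5 ≤ |x i 2 - x j 2| :=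
  fun i j h => (hsf i j h).imp_right fun h' => four_fifths_le_sqrt_two_thirds.trans h'

/-- **`SteepFlatNoGain111`, close-packed threshold.**  The same rung for packings whose bonds have
each `|Δz| ≤ 1/5` or `|Δz| ≥ √(2/3)` (layered films at close-packed spacing, adatom gases). -/
theorem steepFlat_noGain111_sqrt :
    ∃ R C : ℝ, 0 < R ∧
      ∀ ρ : ℝ, R ≤ ρ → ∀ (N : ℕ) (x : Fin N → EuclideanSpace ℝ (Fin 3)), IsUnitPacking x →
        (∀ i j, dist (x i) (x j) = 1 →
          |x i 2 - x j 2| ≤ 1 / 5 ∨ Real.sqrt (2 / 3) ≤ |x i 2 - x j 2|) →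
        (∀ p ∈ fccStacking 1 (Real.sqrt (2 / 3)),
            -(2 * R) ≤ p 2 → p 2 ≤ -R → p 0 ^ 2 + p 1 ^ 2 ≤ ρ ^ 2 → ∃ i, x i = p) →
          2 * Real.sqrt 3 * Real.pi * ρ ^ 2 - C * ρ ≤ 6 * (N : ℝ) - (numContacts x : ℝ) := by
  obtain ⟨R, C, hR, h⟩ := steepFlat_noGain111
  exact ⟨R, C, hR, fun ρ hρ N x hx hsf hsample =>
    h ρ hρ N x hx (steepOrFlat_four_fifths_of_sqrt hsf) hsample⟩

/-- **Corollary: the in-registry rungs, recovered.**  `registry_noGain111`'s conclusion for a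
packing on a translate of one Barlow stacking follows from `steepFlat_noGain111` (same `R`, `C`),
since such packings are steep-or-flat. -/
theorem steepFlat_noGain111_of_sub_mem_barlowStacking :
    ∃ R C : ℝ, 0 < R ∧
      ∀ ρ : ℝ, R ≤ ρ → ∀ (N : ℕ) (x : Fin N → EuclideanSpace ℝ (Fin 3)), IsUnitPacking x →
        (∃ σ : ℤ → ℤ, ∃ v : EuclideanSpace ℝ (Fin 3), IsHaggSeq σ ∧
            ∀ i, x i - v ∈ barlowStacking 1 (Real.sqrt (2 / 3)) σ) →
        (∀ p ∈ fccStacking 1 (Real.sqrt (2 / 3)),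
            -(2 * R) ≤ p 2 → p 2 ≤ -R → p 0 ^ 2 + p 1 ^ 2 ≤ ρ ^ 2 → ∃ i, x i = p) →
          2 * Real.sqrt 3 * Real.pi * ρ ^ 2 - C * ρ ≤ 6 * (N : ℝ) - (numContacts x : ℝ) := by
  obtain ⟨R, C, hR, h⟩ := steepFlat_noGain111_sqrt
  refine ⟨R, C, hR, fun ρ hρ N x hx ⟨σ, v, hσ, hmem⟩ hsample => ?_⟩
  exact h ρ hρ N x hx (steepOrFlat_of_sub_mem_barlowStacking x σ hσ v hmem) hsample


/-! ## The rung in the crux's own vocabulary (`ν = e₃`) -/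

/-- `φ(e₃) = √3`: the crux's inlined surface tension
`(√2/4) Σᶠ_{w ∈ Λ₀, ‖w‖ = 1} |⟪w, ν⟫|` at the layer normal `ν = e₃` of `Λ₀ = fccStacking 1 √(2/3)`
(three of the six `⟨110⟩` classes are horizontal, three have `|w₂| = √(2/3)`; via
`finsum_fccShell_abs_inner`). -/
theorem phiFcc_single_two :
    Real.sqrt 2 / 4 * ∑ᶠ w ∈ {w ∈ fccStacking 1 (Real.sqrt (2 / 3)) | ‖w‖ = 1},
      |⟪w, EuclideanSpace.single (2 : Fin 3) (1 : ℝ)⟫_ℝ| = Real.sqrt 3 := by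
  rw [finsum_fccShell_abs_inner]
  simp only [EuclideanSpace.inner_single_right, one_mul, conj_trivial, PiLp.sub_apply,
    barlowPos_apply_two]
  push_cast
  have h23 : 0 ≤ Real.sqrt (2 / 3) := Real.sqrt_nonneg _
  simp only [zero_mul, one_mul, abs_zero, zero_sub, abs_neg, abs_of_nonneg h23, zero_add, add_zero]
  have h6 : Real.sqrt 2 * Real.sqrt (2 / 3) = 2 / 3 * Real.sqrt 3 := by
    rw [← Real.sqrt_mul (by norm_num : (0:ℝ) ≤ 2), show (2 : ℝ) * (2 / 3) = (2 / 3) ^ 2 * 3 by norm_num,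
      Real.sqrt_mul (by positivity), Real.sqrt_sq (by norm_num : (0:ℝ) ≤ 2 / 3)]
  calc Real.sqrt 2 / 4 * (2 * (Real.sqrt (2 / 3) + Real.sqrt (2 / 3) + Real.sqrt (2 / 3)))
      = 3 / 2 * (Real.sqrt 2 * Real.sqrt (2 / 3)) := by ring
    _ = 3 / 2 * (2 / 3 * Real.sqrt 3) := by rw [h6]
    _ = Real.sqrt 3 := by ring

/-- **The rung as the crux's `ν = e₃` instance, restricted to steep-or-flat packings.**  The inner
statement of `NoReconstructionGain` (stmt-Ventures-19144) at the unit normal `ν = e₃`, with the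
crux's inlined `φ` and slab sample `{p ∈ Λ₀ : −2R ≤ ⟪p,ν⟫ ≤ −R, ‖p‖² − ⟪p,ν⟫² ≤ ρ²}`, holds with
`R = 2`, `C = 8√3π` for every unit packing whose bonds have each `|Δz| ≤ 1/5` or `|Δz| ≥ 4/5`. -/
theorem steepFlat_noReconstructionGain_single_two :
    ∃ R C : ℝ, 0 < R ∧ ∀ ρ : ℝ, R ≤ ρ →
      ∀ (N : ℕ) (x : Fin N → EuclideanSpace ℝ (Fin 3)), IsUnitPacking x →
        (∀ i j, dist (x i) (x j) = 1 →
          |x i 2 - x j 2| ≤ 1 / 5 ∨ 4 / 5 ≤ |x i 2 - x j 2|) →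
        (∀ p ∈ fccStacking 1 (Real.sqrt (2 / 3)),
          -(2 * R) ≤ ⟪p, EuclideanSpace.single (2 : Fin 3) (1 : ℝ)⟫_ℝ →
          ⟪p, EuclideanSpace.single (2 : Fin 3) (1 : ℝ)⟫_ℝ ≤ -R →
          ‖p‖ ^ 2 - ⟪p, EuclideanSpace.single (2 : Fin 3) (1 : ℝ)⟫_ℝ ^ 2 ≤ ρ ^ 2 → ∃ i, x i = p) →
        2 * (Real.sqrt 2 / 4 * ∑ᶠ w ∈ {w ∈ fccStacking 1 (Real.sqrt (2 / 3)) | ‖w‖ = 1},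
              |⟪w, EuclideanSpace.single (2 : Fin 3) (1 : ℝ)⟫_ℝ|) * Real.pi * ρ ^ 2 - C * ρ ≤
          6 * (N : ℝ) - (numContacts x : ℝ) := by
  obtain ⟨R, C, hR, h⟩ := steepFlat_noGain111
  refine ⟨R, C, hR, fun ρ hρ N x hx hsf hsample => ?_⟩
  rw [phiFcc_single_two]
  refine h ρ hρ N x hx hsf fun p hp h1 h2 h3 => hsample p hp ?_ ?_ ?_
  · simpa [EuclideanSpace.inner_single_right] using h1
  · simpa [EuclideanSpace.inner_single_right] using h2
  · have e : ‖p‖ ^ 2 - ⟪p, EuclideanSpace.single (2 : Fin 3) (1 : ℝ)⟫_ℝ ^ 2 = p 0 ^ 2 + p 1 ^ 2 := by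
      rw [EuclideanSpace.real_norm_sq_eq, Fin.sum_univ_three]
      simp [EuclideanSpace.inner_single_right]
    rw [e]; exact h3

end Summit.Ventures.Crystal3D.Theorems

end
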